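import Summits.Ventures.HSemireg.WedgeHankelRecurrenceGaussChebyshevUCoprimeIff

/-!
# Venture HSemireg — **`Res(U_m, U_n) = 0 ⟺ gcd(m+1, n+1) ≠ 1` AND THE COMMON REAL ZEROS OF `U_m`, `U_n`**: by N453 (`IsCoprime U_m U_n ⟺ gcd(m+1,n+1) = 1` over `ℝ`), Mathlib's
# `resultant_eq_zero_iff` and `resultant_map_map`, the INTEGER resultant of Mathlib's `U_m`, `U_n` vanishes iff `gcd(m+1, n+1) ≠ 1`; and `U_m`, `U_n` share a real zero iff `gcd(m+1,n+1) ≠ 1`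
# (the zero `cos(π∕d)` of `U_{d−1}`, `d = gcd`, via the nesting `U_{d−1} ∣ U_{kd−1}` of N438) — disjointness criterion for the second-kind Gauss–Chebyshev ∕ Fejér node sets

HONEST FRAMING. Part of the Lean index of the computation cell `pub-hsemireg` (seat p10 gen 47, Sunday typer «UNIFORM-IN-n»).  Polynomial algebra and one trigonometric evaluation (Mathlib
`U_real_cos`) only; no variety, no cohomology theory, no sheaf, no Ext group and no semiregularity map is constructed here; nothing here says that HC / HC_CM / HC_AV holds; no Literature fact
(unproved `Prop`) is declared or used.  Custodian versions as in `WedgeHankelSiegelIdeal` (1/3).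
SOURCES (cited).  K. Dilcher, K. B. Stolarsky, Trans. Amer. Math. Soc. 357 (2005) 965–981, Thm 3 (`Res(U_m, U_n) ≠ 0 ⟺ gcd(m+1,n+1) = 1`, with the explicit value); M. O. Rayes, V. Trevisan, P. S.
Wang, Comput. Math. Appl. 50 (2005) 1231–1240; J. C. Mason, D. C. Handscomb, *Chebyshev Polynomials* (2003), Ch. 8.  The vanishing criterion is the COROLLARY typed here of N453 (the explicit
nonzero value is not typed).
PROOF TYPED HERE.  N453 `chebyshevU_isCoprime_iff_coprime_succ`; Mathlib `resultant_eq_zero_iff`, `resultant_map_map`, `map_U`, `natDegree_U_natCast`, `U_ne_zero`, `U_real_cos`,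
`eval_eq_zero_of_dvd_of_eval_eq_zero`; N438 `chebyshevU_dvd_U_mul_pred`.
DEDUP DISCLOSURE (`rg -n -i 'U_resultant_eq_zero_iff|U_common_real_zero' Summits/Ventures/HSemireg`, 2026-09-04): N431 (`gap two ⟺ n odd`), N434, N439 (particular vanishing families); 0 hits for
the 3 names below.

WHAT IS IN THE TREE.  N453; N438; N431 ∕ N434 ∕ N439 (special cases); Mathlib as listed.
THIS FILE (namespace `Summit.Ventures.HSemireg.Wedge.HankelOuter` continued; CHAINED on N453; 0 definitions):
* §1219 **`chebyshevU_resultant_eq_zero_iff`** (`Res_{(m,n)}(U_m, U_n) = 0` over `ℤ` `⟺ ¬ Nat.Coprime (m+1) (n+1)`), `chebyshevU_eval_cos_pi_div` (`U_{d−1}(cos(π∕d)) = 0`, `d ≥ 2`),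
  **`chebyshevU_common_real_zero_iff`** (`(∃ x, U_m(x) = U_n(x) = 0) ⟺ ¬ Nat.Coprime (m+1) (n+1)`).
CAVEATS.  The explicit nonzero value of `Res(U_m, U_n)` (Dilcher–Stolarsky) is not typed.  Nothing Ext-side.  New names only.
-/

open Module Polynomial Real
open scoped Matrix Polynomial

namespace Summit.Ventures.HSemireg.Wedge.HankelOuter

/-! ## §1219. `Res(U_m, U_n) = 0` iff `gcd(m+1, n+1) ≠ 1` -/

/-- **`Res_{(m,n)}(U_m, U_n) = 0 ⟺ gcd(m+1, n+1) ≠ 1`** (integer resultant of Mathlib's `U`). [Dilcher–Stolarsky 2005 Thm 3 (vanishing part); this file, §1219] -/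
theorem chebyshevU_resultant_eq_zero_iff (m n : ℕ) :
    (Polynomial.Chebyshev.U ℤ (m : ℤ)).resultant (Polynomial.Chebyshev.U ℤ (n : ℤ)) m n = 0 ↔ ¬ Nat.Coprime (m + 1) (n + 1) := by
  have hmap := Polynomial.resultant_map_map (f := Polynomial.Chebyshev.U ℤ (m : ℤ)) (g := Polynomial.Chebyshev.U ℤ (n : ℤ)) (m := m) (n := n) (Int.castRingHom ℝ)
  rw [Polynomial.Chebyshev.map_U, Polynomial.Chebyshev.map_U] at hmap
  have hdef : (Polynomial.Chebyshev.U ℝ (m : ℤ)).resultant (Polynomial.Chebyshev.U ℝ (n : ℤ)) m n =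
      (Polynomial.Chebyshev.U ℝ (m : ℤ)).resultant (Polynomial.Chebyshev.U ℝ (n : ℤ)) := by
    rw [Polynomial.Chebyshev.natDegree_U_natCast, Polynomial.Chebyshev.natDegree_U_natCast]
  rw [← Int.cast_eq_zero (α := ℝ), ← eq_intCast (Int.castRingHom ℝ), ← hmap, hdef, Polynomial.resultant_eq_zero_iff,
    ← chebyshevU_isCoprime_iff_coprime_succ (K := ℝ) two_ne_zero m n]
  exact ⟨fun h => h.2, fun h => ⟨Or.inl (Polynomial.Chebyshev.U_ne_zero ℝ _ (by omega)), h⟩⟩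

/-- `U_{d−1}(cos(π∕d)) = 0` for `d ≥ 2`. [Szegő (1.12.3); Mathlib `U_real_cos`; this file, §1219] -/
theorem chebyshevU_eval_cos_pi_div {d : ℕ} (hd : 2 ≤ d) : (Polynomial.Chebyshev.U ℝ ((d : ℤ) - 1)).eval (cos (π / d)) = 0 := by
  have h := Polynomial.Chebyshev.U_real_cos (π / d) ((d : ℤ) - 1)
  have hd0 : (0 : ℝ) < d := by exact_mod_cast (show 0 < d by omega)
  rw [show (((d : ℤ) - 1 : ℤ) : ℝ) + 1 = (d : ℝ) by push_cast; ring, mul_div_cancel₀ _ hd0.ne', Real.sin_pi] at h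
  have hsin : sin (π / d) ≠ 0 := by
    refine (Real.sin_pos_of_pos_of_lt_pi (by positivity) ?_).ne'
    rw [div_lt_iff₀ hd0]
    have : (2 : ℝ) ≤ d := by exact_mod_cast hd
    nlinarith [Real.pi_pos]
  exact (mul_eq_zero.1 h).resolve_right hsin

/-- **`U_m` and `U_n` have a common real zero iff `gcd(m+1, n+1) ≠ 1`** (the zero `cos(π∕d)`, `d = gcd(m+1,n+1)`). [Mason–Handscomb Ch. 8; Dilcher–Stolarsky 2005; this file, §1219] -/
theorem chebyshevU_common_real_zero_iff (m n : ℕ) :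
    (∃ x : ℝ, (Polynomial.Chebyshev.U ℝ (m : ℤ)).eval x = 0 ∧ (Polynomial.Chebyshev.U ℝ (n : ℤ)).eval x = 0) ↔ ¬ Nat.Coprime (m + 1) (n + 1) := by
  constructor
  · rintro ⟨x, hm, hn⟩ hcop
    obtain ⟨u, v, huv⟩ := (chebyshevU_isCoprime_iff_coprime_succ (K := ℝ) two_ne_zero m n).2 hcop
    have e := congrArg (Polynomial.eval x) huv
    rw [eval_add, eval_mul, eval_mul, hm, hn, mul_zero, mul_zero, add_zero, eval_one] at e
    exact zero_ne_one e
  · intro h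
    set d := Nat.gcd (m + 1) (n + 1) with hd
    have hd1 : d ≠ 1 := h
    have hd0 : d ≠ 0 := by rw [hd]; exact Nat.gcd_ne_zero_left (Nat.succ_ne_zero m)
    have hd2 : 2 ≤ d := by omega
    obtain ⟨k, hk⟩ := Nat.gcd_dvd_left (m + 1) (n + 1)
    obtain ⟨l, hl⟩ := Nat.gcd_dvd_right (m + 1) (n + 1)
    refine ⟨cos (π / d), ?_, ?_⟩
    · have hdvd := chebyshevU_dvd_U_mul_pred (R := ℝ) k ((d : ℤ) - 1)
      rw [sub_add_cancel, show (k : ℤ) * (d : ℤ) - 1 = (m : ℤ) by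
        have : ((m + 1 : ℕ) : ℤ) = ((d * k : ℕ) : ℤ) := by rw [← hk]
        push_cast at this; linarith] at hdvd
      exact eval_eq_zero_of_dvd_of_eval_eq_zero hdvd (chebyshevU_eval_cos_pi_div hd2)
    · have hdvd := chebyshevU_dvd_U_mul_pred (R := ℝ) l ((d : ℤ) - 1)
      rw [sub_add_cancel, show (l : ℤ) * (d : ℤ) - 1 = (n : ℤ) by
        have : ((n + 1 : ℕ) : ℤ) = ((d * l : ℕ) : ℤ) := by rw [← hl]
        push_cast at this; linarith] at hdvd
      exact eval_eq_zero_of_dvd_of_eval_eq_zero hdvd (chebyshevU_eval_cos_pi_div hd2)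

end Summit.Ventures.HSemireg.Wedge.HankelOuter
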